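import Summits.HodgeConjecture.HodgeConjecture.Theorems.F0LD1ThetaTransportKit
import Summits.HodgeConjecture.HodgeConjecture.Theorems.F0P6LD1ThetaCharacterPin
import Summits.HodgeConjecture.HodgeConjecture.Theorems.F0P6LD1TransportRational
import Summits.HodgeConjecture.HodgeConjecture.Theorems.F0LD2FrameTransportPin
import HarnessLib

-- As in the lineage (`ThetaLiftFromLineCharacters`, `F0LD1ThetaTransportKit`): statements over the theta-kernel datum elaborate to very large
-- types; elaborate sequentially.
set_option Elab.async false

/-!
# Crux `HLiu418`, line LD1 (`stub_S1_facts` in-house), organ (I) — piece (I-B): A SEAM FROM A LINE IS A CHARACTER SEAM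
# («`Meets(P, a, ιA) ⇒ ∃ ξ, CharSeam₂(P, a, ξ)`», the `ξ`-theta class lying IN `P`, not merely projecting non-trivially)

Cell `hodgecm-mathlib`, FLOOR 0, line LD1 (socket 27458 `Cruxes/HLiu418/Lines/F0_AlbCm.lean`, stub `stub_S1_facts` = books #73 E1θhol [Liu2021,
Prop. D.4 (1)]); skeleton v7 `F0/P6/LD/LD1-plan/g0/StubS1facts.inhouse.skeleton.v7.lean` (e4119f23732f6444), organ (I) `stub_thetaCharRigid : ThetaCharRigid₂`
= (I-B) seam half ∧ (I-A) irreducibility half; THIS FILE = (I-B) (deal LD1-plan (g0) 03:24:12Z to seat LD1-p02 (g0)); `--supports stmt-HodgeConjecture-24832`.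
THEOREMS ONLY — no definition, no instance, no notation, no `sorry`.

THE MATHEMATICS ([Liu2021, proof of Prop. 4.13 Case 1, l. 2131–2137: «`π_W` is a character … `V_π = Θ^V(π_W)` … the central character `χ` of `π`»];
[GelbartRogawski1991, §3.1–§3.2]).  Let `P ⊂ L²([U(H)])` be irreducible, containing the non-zero class `v = [Θ̃_Φ(f) ∘ ιA]` of a theta lift from the
hermitian line `⟨a⟩` with a continuous weight `f` on the compact abelian group `[U(⟨a⟩)]`.  For a continuous unitary character `χ` put
`v_χ := [Θ̃_Φ(χ) ∘ ιA]`.  (1) The centre `Z(U(H)) = U(1)` acts on `P` through a character `ψ` (Schur, ★ `exists_centralCharacter_adelicCenter`) and on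
`v_χ` through `χ ∘ (u ↦ [u·1_W])` (★ `F0P6LD1ThetaCharacterPin.rightRegular_adelicCenter_toLp_transport_charCM`); the orthogonal projection `pr_P`
commutes with the group (★ `ClosedSubrep.starProjection_map_apply`), so `pr_P v_χ ≠ 0` forces `ψ = χ ∘ (u ↦ [u·1_W])`, which pins `χ` (the centre
EXHAUSTS the line, ★ `charQuot_ext_of_adelicCenter`): there is at most one `ξ` with `pr_P v_ξ ≠ 0`, and there is one (★ K1
`exists_charCM_of_apply_toLp_lineThetaLift_ne_zero` with `T = pr_P`, since `pr_P v = v ≠ 0`).  (2) For `χ ≠ ξ`: `v_χ ⊥ P` and `v_χ ⊥ v_ξ` (eigenvectors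
of the unitary `R(u·1_H)` for distinct unit eigenvalues).  (3) Put `w₀ := v − (⟪v_ξ,v⟫/⟪v_ξ,v_ξ⟫) v_ξ`; then `⟪w₀, v_χ⟫ = 0` for EVERY `χ`, so by the
density of characters (★ K1 again, `T = ⟪w₀, ·⟫`) `⟪w₀, v⟫ = 0`, whence `w₀ = 0`: `v` is a non-zero multiple of `v_ξ`, and `v_ξ ∈ P`, `v_ξ ≠ 0`.
No named fact; no multiplicity one; no construction of `ξ` from `ψ`.  The transport `ιA` is ABSTRACT, pinned by the GL-formula `g_𝔸⁻¹ k g_𝔸` alone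
(continuity ★ `F0LD2FrameTransportPin.continuous_of_pin`; rational points ★ `F0P6LD1TransportRational.transport_toAdelic_mem_range`).
HONEST LABEL: HC_CM is proved only modulo the 7 printed citations (2 remaining: hLiu418 = stmt-HodgeConjecture-24832, h413 = stmt-HodgeConjecture-24833)
until rung 0 closes; this file discharges none of them (in-house helper toward organ (I) of line LD1).

## References
* [Liu2021] Y. Liu, Camb. J. Math. 9 (2021) = arXiv:2102.11518: proof of Prop. 4.13 Case 1 (l. 2131–2137, p. 48); App. D, proof of Prop. D.4 (1) (p. 131).
* [GelbartRogawski1991] S. Gelbart, J. Rogawski, Invent. Math. 105 (1991), §3.1 Prop. 3.1.1 p. 455, Remark p. 457; §3.2 p. 457.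
* [DeitmarEchterhoff2014] A. Deitmar, S. Echterhoff, *Principles of Harmonic Analysis*, 2nd ed. (2014), Prop. 3.5.2 (characters span), Lemma 6.1.7 (Schur).
* [Bump1997] D. Bump, *Automorphic Forms and Representations* (1997), Thm. 3.6.1 (proof, p. 342: projections commute with the group).
-/

set_option autoImplicit false
-- the mandated namespace has the single-problem summit's repeated segment (`HodgeConjecture.HodgeConjecture`)
set_option linter.dupNamespace false

noncomputable section

open NumberField MeasureTheory IsDedekindDomain
open scoped Matrix ComplexOrder ENNReal InnerProductSpace ComplexConjugate
open Literature.NumberTheory.Automorphic Literature.NumberTheory.Automorphic.UnitaryGroup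
open Literature.NumberTheory.Automorphic.UnitaryGroup.CotangentForms
open Literature.NumberTheory.Automorphic.IdeleClassGroup
open Literature.NumberTheory.Automorphic.Liu2021
open Literature.NumberTheory.Automorphic.Liu2021.Def411WeilCarriers
open Literature.NumberTheory.Automorphic.Liu2021.Def411WeilCarriersDoubling
open Literature.NumberTheory.GelbartRogawski1991 Literature.NumberTheory.GelbartRogawski1991.UnitaryDualPair
open Literature.NumberTheory.Weil1964
open Literature.RepresentationTheory.Liu2021
open Literature.RepresentationTheory.CompactGroups

namespace Summit.HodgeConjecture.HodgeConjecture.Cruxes.HLiu418.F0P6LD1ThetaSeamCharacter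

/-! ## §0 Two generic Hilbert-space facts -/

section Hilbert

variable {K : Type} [Field K] [NumberField K] {𝒢 : AdelicGroupData.{0} K}
  {ν : Measure 𝒢.automorphicQuotient} [𝒢.IsAutomorphicMeasure ν]

/-- The right regular representation preserves inner products (it is unitary, ★ `norm_rightRegular_apply`). [cite: BorelJacquet1979, §4.6] -/
theorem inner_rightRegular_rightRegular (x : 𝒢.Adelic) (u v : 𝒢.L2 ν) :
    ⟪𝒢.rightRegular ν x u, 𝒢.rightRegular ν x v⟫_ℂ = ⟪u, v⟫_ℂ :=
  let T : 𝒢.L2 ν →ₗᵢ[ℂ] 𝒢.L2 ν :=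
    { toLinearMap := (𝒢.rightRegular ν x : 𝒢.L2 ν →L[ℂ] 𝒢.L2 ν).toLinearMap
      norm_map' := 𝒢.norm_rightRegular_apply ν x }
  T.inner_map_map u v

/-- **Eigenvectors of one unitary operator `R(x)` for DISTINCT unit eigenvalues are orthogonal.** [cite: DeitmarEchterhoff2014, Lemma 6.1.7] -/
theorem inner_eq_zero_of_eigen_ne (x : 𝒢.Adelic) {u v : 𝒢.L2 ν} {c d : Circle}
    (hu : 𝒢.rightRegular ν x u = ((c : Circle) : ℂ) • u) (hv : 𝒢.rightRegular ν x v = ((d : Circle) : ℂ) • v) (hcd : c ≠ d) :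
    ⟪u, v⟫_ℂ = 0 := by
  have h := inner_rightRegular_rightRegular (ν := ν) x u v
  rw [hu, hv, inner_smul_left, inner_smul_right, ← mul_assoc] at h
  have hne : (starRingEnd ℂ) ((c : Circle) : ℂ) * ((d : Circle) : ℂ) ≠ 1 := by
    intro h1
    apply hcd
    have h2 : ((c : Circle) : ℂ) * ((starRingEnd ℂ) ((c : Circle) : ℂ) * ((d : Circle) : ℂ)) = (c : ℂ) := by rw [h1, mul_one]
    rw [← mul_assoc, Complex.mul_conj, Complex.normSq_eq_norm_sq, Circle.norm_coe, one_pow, Complex.ofReal_one, one_mul] at h2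
    exact Circle.ext h2.symm
  have h3 : ((starRingEnd ℂ) ((c : Circle) : ℂ) * ((d : Circle) : ℂ) - 1) * ⟪u, v⟫_ℂ = 0 := by rw [sub_mul, one_mul, h, sub_self]
  rcases mul_eq_zero.mp h3 with h4 | h4
  · exact absurd (sub_eq_zero.mp h4) hne
  · exact h4

end Hilbert

/-! ## §1 (I-B): a seam from a line is a character seam -/

section Seam

variable (L : Type) [Field L] [NumberField L] [IsCMField L] (N : ℕ) (H : Matrix (Fin N) (Fin N) L)
  {n' : ℕ} (e₁ : Fin N × Fin 1 ≃ Fin n') (dV : Fin N → L) (hdV : ∀ i, IsCMField.complexConj L (dV i) = dV i)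
  (hdV0 : ∀ i, dV i ≠ 0) (g : GL (Fin N) L)
  (lam : Literature.NumberTheory.Automorphic.IdeleClassGroup L →ₜ* Circle) (hlam : IsConjugateSymplectic L lam) (a : (↥(maximalRealSubfield L))ˣ)
  (ιA : (adelicGroupData (↥(maximalRealSubfield L)) L (IsCMField.complexConj L) N H).Adelic →*
    ↥(UnitaryGroup.adelic (↥(maximalRealSubfield L)) L (IsCMField.complexConj L) N (Matrix.diagonal dV)))
  (hιA : ∀ k, ((ιA k : ↥(UnitaryGroup.adelic (↥(maximalRealSubfield L)) L (IsCMField.complexConj L) N (Matrix.diagonal dV))) :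
      GL (Fin N) (AdeleRing (𝓞 L) L)) =
    (toAdeleGL L g)⁻¹ * adelicVal (↥(maximalRealSubfield L)) L (IsCMField.complexConj L) N H k * toAdeleGL L g)

include hιA

/-- The kit hypothesis of ★ `F0LD1ThetaTransportKit` («continuous ∧ rational points to rational points») from the GL-formula alone
(continuity ★ `F0LD2FrameTransportPin.continuous_of_pin`; rational points ★ `F0P6LD1TransportRational.transport_toAdelic_mem_range`). [cite: Mok2014, §1 Notation p. 5] -/
theorem kitHypothesis_of_pin :
    Continuous ιA ∧ ∀ ⦃γ : (adelicGroupData (↥(maximalRealSubfield L)) L (IsCMField.complexConj L) N H).Adelic⦄,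
      γ ∈ (UnitaryGroup.toAdelic (↥(maximalRealSubfield L)) L (IsCMField.complexConj L) N H).range →
        ιA γ ∈ (UnitaryGroup.toAdelic (↥(maximalRealSubfield L)) L (IsCMField.complexConj L) N (Matrix.diagonal dV)).range := by
  refine ⟨F0LD2FrameTransportPin.continuous_of_pin L N H dV g ιA hιA, fun γ hγ => ?_⟩
  obtain ⟨γ₀, rfl⟩ := hγ
  exact F0P6LD1TransportRational.transport_toAdelic_mem_range L N H dV g ιA hιA γ₀

variable
  [CompactSpace (↥(UnitaryGroup.adelic (↥(maximalRealSubfield L)) L (IsCMField.complexConj L) N (Matrix.diagonal dV)) ⧸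
    (UnitaryGroup.toAdelic (↥(maximalRealSubfield L)) L (IsCMField.complexConj L) N (Matrix.diagonal dV)).range)]
  {μA : Measure (adelicGroupData (↥(maximalRealSubfield L)) L (IsCMField.complexConj L) N H).automorphicQuotient}
  [(adelicGroupData (↥(maximalRealSubfield L)) L (IsCMField.complexConj L) N H).IsAutomorphicMeasure μA]
  [CompactSpace (adelicGroupData (↥(maximalRealSubfield L)) L (IsCMField.complexConj L) N H).automorphicQuotient]

set_option maxHeartbeats 3200000 in
/-- **(I-B) — A SEAM FROM A LINE IS A CHARACTER SEAM.**  For the letter's field ∕ form ∕ frame ∕ splitting data, `[U(diag dV)]` and `[U(H)]` compact, an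
ABSTRACT transport `ιA` pinned by `↑(ιA k) = g_𝔸⁻¹ k g_𝔸`, a discrete automorphic `P` of `U(H)` and a line `⟨a⟩`: if `P` MEETS the theta lift from `⟨a⟩` at
`λ` along `ιA` (★ `MeetsThetaLiftFromLine`: a non-zero class `[Θ̃_Φ(f) ∘ ιA] ∈ P` for some continuous weight `f`), then for some continuous unitary CHARACTER
`ξ` of `[U(⟨a⟩)]` the class `[Θ̃_Φ(ξ) ∘ ιA]` (SAME majorant witness, measure and `Φ`) lies IN `P` and is non-zero — the body of the LD1 skeleton's
`CharSeam₂ … P lam hlam a ιA ξ`, unfolded (the leaf `Lines/F0_P6LD_StubS1FactsThetaRoad` folds it by name).  Proof = the module docstring (1)–(3).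
[cite: Liu2021, proof of Prop. 4.13 Case 1 (l. 2131–2137, p. 48); App. D, proof of Prop. D.4 (1) p. 131] [cite: GelbartRogawski1991, §3.2 p. 457]
[cite: DeitmarEchterhoff2014, Prop. 3.5.2; Lemma 6.1.7] [cite: Bump1997, Thm. 3.6.1 (proof, p. 342)] -/
theorem exists_charSeam_of_meets
    (P : DiscreteAutomorphicRep (adelicGroupData (↥(maximalRealSubfield L)) L (IsCMField.complexConj L) N H) μA)
    (hmeets : MeetsThetaLiftFromLine L N H e₁ dV hdV hdV0 P lam hlam a ιA) :
    letI : MeasurableSpace (↥(UnitaryGroup.adelic (↥(maximalRealSubfield L)) L (IsCMField.complexConj L) 1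
        (JW (↥(maximalRealSubfield L)) L a)) ⧸
          (UnitaryGroup.toAdelic (↥(maximalRealSubfield L)) L (IsCMField.complexConj L) 1 (JW (↥(maximalRealSubfield L)) L a)).range) :=
      borel _
    haveI := normal_range_toAdelic_JW L a
    ∃ (ξ : PontryaginDual (↥(UnitaryGroup.adelic (↥(maximalRealSubfield L)) L (IsCMField.complexConj L) 1 (JW (↥(maximalRealSubfield L)) L a)) ⧸
          (UnitaryGroup.toAdelic (↥(maximalRealSubfield L)) L (IsCMField.complexConj L) 1 (JW (↥(maximalRealSubfield L)) L a)).range))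
      (hρ : HasThetaMajorants fun
        (p : ↥(UnitaryGroup.adelic (↥(maximalRealSubfield L)) L (IsCMField.complexConj L) N (Matrix.diagonal dV)) ×
          ↥(UnitaryGroup.adelic (↥(maximalRealSubfield L)) L (IsCMField.complexConj L) 1 (JW (↥(maximalRealSubfield L)) L a)))
        (Φ : piSchwartzBruhat (↥(maximalRealSubfield L)) (Fin n')) =>
          pairRep (↥(maximalRealSubfield L)) L (IsCMField.complexConj L) N 1 e₁ (Matrix.diagonal dV) (JW (↥(maximalRealSubfield L)) L a)
            (chiSplittingLine L e₁ dV hdV hdV0 (toHeckeCharacter L lam) (isUnitary_toHeckeCharacter L lam)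
              ((isOscillatorChar_toHeckeCharacter_iff lam).mpr hlam) (TW (↥(maximalRealSubfield L)) a)
              (isUnit_det_TW (↥(maximalRealSubfield L)) a) (JW (↥(maximalRealSubfield L)) L a) (JW_eq (↥(maximalRealSubfield L)) L a))
            p Φ)
      (μW : Measure (↥(UnitaryGroup.adelic (↥(maximalRealSubfield L)) L (IsCMField.complexConj L) 1
        (JW (↥(maximalRealSubfield L)) L a)) ⧸
          (UnitaryGroup.toAdelic (↥(maximalRealSubfield L)) L (IsCMField.complexConj L) 1 (JW (↥(maximalRealSubfield L)) L a)).range))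
      (_ : IsFiniteMeasure μW)
      (_ : SMulInvariantMeasure
        (↥(UnitaryGroup.adelic (↥(maximalRealSubfield L)) L (IsCMField.complexConj L) 1 (JW (↥(maximalRealSubfield L)) L a)))
        (↥(UnitaryGroup.adelic (↥(maximalRealSubfield L)) L (IsCMField.complexConj L) 1 (JW (↥(maximalRealSubfield L)) L a)) ⧸
          (UnitaryGroup.toAdelic (↥(maximalRealSubfield L)) L (IsCMField.complexConj L) 1 (JW (↥(maximalRealSubfield L)) L a)).range)
        μW)
      (Ψ : piSchwartzBruhat (↥(maximalRealSubfield L)) (Fin n'))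
      (hθ : MemLp (toQuotFun (adelicGroupData (↥(maximalRealSubfield L)) L (IsCMField.complexConj L) N H) fun x =>
        (lineThetaKernelDatum L N e₁ dV hdV hdV0 lam hlam a hρ).thetaLiftFun μW Ψ (charCM ξ) (ιA x)) 2 μA),
      MemLp.toLp _ hθ ∈ P.space.toSubmodule ∧ MemLp.toLp _ hθ ≠ 0 := by
  letI iM : MeasurableSpace (↥(UnitaryGroup.adelic (↥(maximalRealSubfield L)) L (IsCMField.complexConj L) 1
      (JW (↥(maximalRealSubfield L)) L a)) ⧸
        (UnitaryGroup.toAdelic (↥(maximalRealSubfield L)) L (IsCMField.complexConj L) 1 (JW (↥(maximalRealSubfield L)) L a)).range) :=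
    borel _
  haveI : BorelSpace (↥(UnitaryGroup.adelic (↥(maximalRealSubfield L)) L (IsCMField.complexConj L) 1
      (JW (↥(maximalRealSubfield L)) L a)) ⧸
        (UnitaryGroup.toAdelic (↥(maximalRealSubfield L)) L (IsCMField.complexConj L) 1 (JW (↥(maximalRealSubfield L)) L a)).range) := ⟨rfl⟩
  haveI := normal_range_toAdelic_JW L a
  obtain ⟨hρ, μW, hfin, hinv, f, Φ, hθf, hmem, hne⟩ := hmeets
  haveI := hfin
  haveI := hinv
  have hK := kitHypothesis_of_pin L N H dV g ιA hιA
  have hιArat : ∀ γ : (adelicGroupData (↥(maximalRealSubfield L)) L (IsCMField.complexConj L) N H).Rational,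
      ιA ((adelicGroupData (↥(maximalRealSubfield L)) L (IsCMField.complexConj L) N H).toAdelic γ) ∈
        (UnitaryGroup.toAdelic (↥(maximalRealSubfield L)) L (IsCMField.complexConj L) N (Matrix.diagonal dV)).range :=
    F0P6LD1TransportRational.transport_toAdelic_mem_range L N H dV g ιA hιA
  -- the classes `v_f'` of the lifts of continuous weights
  have hmw : ∀ f', MemLp (toQuotFun (adelicGroupData (↥(maximalRealSubfield L)) L (IsCMField.complexConj L) N H) fun x => (lineThetaKernelDatum L N e₁ dV hdV hdV0 lam hlam a hρ).thetaLiftFun μW Φ f' (ιA x)) 2 μA :=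
    fun f' => F0LD1ThetaTransportKit.memLp_toQuotFun_lineThetaLift L N H e₁ dV hdV hdV0 ιA hK lam hlam a hρ μW Φ f' μA 2
  set v : (adelicGroupData (↥(maximalRealSubfield L)) L (IsCMField.complexConj L) N H).L2 μA := MemLp.toLp _ hθf with hv
  have hvf : v = MemLp.toLp _ (hmw f) := rfl
  -- the central character of `P`
  obtain ⟨ψ, -, -, -, hψ⟩ := P.exists_centralCharacter_adelicCenter
  -- eigen-relation of the character classes under the centre (★ `F0P6LD1ThetaCharacterPin`)
  have heig : ∀ (χ : PontryaginDual (↥(UnitaryGroup.adelic (↥(maximalRealSubfield L)) L (IsCMField.complexConj L) 1 (JW (↥(maximalRealSubfield L)) L a)) ⧸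
        (UnitaryGroup.toAdelic (↥(maximalRealSubfield L)) L (IsCMField.complexConj L) 1 (JW (↥(maximalRealSubfield L)) L a)).range))
      (u : ↥(adelicOne (↥(maximalRealSubfield L)) L (IsCMField.complexConj L))),
      (adelicGroupData (↥(maximalRealSubfield L)) L (IsCMField.complexConj L) N H).rightRegular μA (adelicCenter (↥(maximalRealSubfield L)) L (IsCMField.complexConj L) N H u) (MemLp.toLp _ (hmw (charCM χ))) =
        ((χ (QuotientGroup.mk (adelicCenter (↥(maximalRealSubfield L)) L (IsCMField.complexConj L) 1 (JW (↥(maximalRealSubfield L)) L a) u)) :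
            Circle) : ℂ) • MemLp.toLp _ (hmw (charCM χ)) :=
    fun χ u => F0P6LD1ThetaCharacterPin.rightRegular_adelicCenter_toLp_transport_charCM L N H e₁ dV hdV hdV0 g lam hlam a hρ ιA hιA hιArat μW Φ
      μA u χ (hmw (charCM χ))
  -- (1a) a character class with `pr_P ≠ 0` has `χ ∘ centre = ψ`
  have hpin : ∀ χ : PontryaginDual (↥(UnitaryGroup.adelic (↥(maximalRealSubfield L)) L (IsCMField.complexConj L) 1 (JW (↥(maximalRealSubfield L)) L a)) ⧸
        (UnitaryGroup.toAdelic (↥(maximalRealSubfield L)) L (IsCMField.complexConj L) 1 (JW (↥(maximalRealSubfield L)) L a)).range),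
      P.space.toSubmodule.starProjection (MemLp.toLp _ (hmw (charCM χ))) ≠ 0 →
      ∀ u : ↥(adelicOne (↥(maximalRealSubfield L)) L (IsCMField.complexConj L)),
        ((ψ u : ℂˣ) : ℂ) =
          ((χ (QuotientGroup.mk (adelicCenter (↥(maximalRealSubfield L)) L (IsCMField.complexConj L) 1 (JW (↥(maximalRealSubfield L)) L a) u)) :
            Circle) : ℂ) := by
    intro χ hpr u
    set w := P.space.toSubmodule.starProjection (MemLp.toLp _ (hmw (charCM χ))) with hw
    have hwmem : w ∈ P.space.toSubmodule := Submodule.starProjection_apply_mem _ _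
    have hR : (adelicGroupData (↥(maximalRealSubfield L)) L (IsCMField.complexConj L) N H).rightRegular μA (adelicCenter (↥(maximalRealSubfield L)) L (IsCMField.complexConj L) N H u) w =
        ((χ (QuotientGroup.mk (adelicCenter (↥(maximalRealSubfield L)) L (IsCMField.complexConj L) 1 (JW (↥(maximalRealSubfield L)) L a) u)) :
          Circle) : ℂ) • w := by
      rw [hw, ← ContRepresentation.ClosedSubrep.starProjection_map_apply ((adelicGroupData (↥(maximalRealSubfield L)) L (IsCMField.complexConj L) N H).isUnitary_rightRegular μA) P.space, heig χ u, map_smul]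
    have hψw : (adelicGroupData (↥(maximalRealSubfield L)) L (IsCMField.complexConj L) N H).rightRegular μA (adelicCenter (↥(maximalRealSubfield L)) L (IsCMField.complexConj L) N H u) w = ((ψ u : ℂˣ) : ℂ) • w := by
      have h := congrArg Subtype.val (hψ u ⟨w, hwmem⟩)
      rw [ContRepresentation.ClosedSubrep.coe_toContRep_apply] at h
      exact h
    rw [hψw] at hR
    exact smul_left_injective ℂ hpr hR
  -- (1b) hence at most one character class projects non-trivially
  have huniq : ∀ χ χ' : PontryaginDual (↥(UnitaryGroup.adelic (↥(maximalRealSubfield L)) L (IsCMField.complexConj L) 1 (JW (↥(maximalRealSubfield L)) L a)) ⧸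
        (UnitaryGroup.toAdelic (↥(maximalRealSubfield L)) L (IsCMField.complexConj L) 1 (JW (↥(maximalRealSubfield L)) L a)).range),
      P.space.toSubmodule.starProjection (MemLp.toLp _ (hmw (charCM χ))) ≠ 0 →
      P.space.toSubmodule.starProjection (MemLp.toLp _ (hmw (charCM χ'))) ≠ 0 → χ = χ' := by
    intro χ χ' h h'
    refine F0P6LD1ThetaCharacterPin.charQuot_ext_of_adelicCenter L a χ χ' fun u => Circle.ext ?_
    rw [← hpin χ h u, ← hpin χ' h' u]
  -- (1c) and there is one: `pr_P v = v ≠ 0` (★ K1 density lemma with `T := pr_P`)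
  have hprv : P.space.toSubmodule.starProjection v ≠ 0 := by
    rw [Submodule.starProjection_eq_self_iff.mpr hmem]
    exact hne
  obtain ⟨ξ, hξ⟩ := F0LD1ThetaTransportKit.exists_charCM_of_apply_toLp_lineThetaLift_ne_zero L N H e₁ dV hdV hdV0 ιA hK lam hlam a hρ μW Φ f
    μA P.space.toSubmodule.starProjection (hvf ▸ hprv)
  set vξ : (adelicGroupData (↥(maximalRealSubfield L)) L (IsCMField.complexConj L) N H).L2 μA := MemLp.toLp _ (hmw (charCM ξ)) with hvξ
  have hvξ0 : vξ ≠ 0 := fun h0 => hξ (by rw [h0, map_zero])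
  -- (2) for `χ ≠ ξ`: `v_χ ⊥ P` and `v_χ ⊥ v_ξ`
  have horthP : ∀ χ, χ ≠ ξ → MemLp.toLp _ (hmw (charCM χ)) ∈ P.space.toSubmoduleᗮ := by
    intro χ hχ
    rw [← Submodule.starProjection_apply_eq_zero_iff]
    by_contra h
    exact hχ (huniq χ ξ h hξ)
  have horthξ : ∀ χ, χ ≠ ξ → ⟪vξ, MemLp.toLp _ (hmw (charCM χ))⟫_ℂ = 0 := by
    intro χ hχ
    -- a central element on which the two characters differ
    have hex : ∃ u : ↥(adelicOne (↥(maximalRealSubfield L)) L (IsCMField.complexConj L)),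
        ξ (QuotientGroup.mk (adelicCenter (↥(maximalRealSubfield L)) L (IsCMField.complexConj L) 1 (JW (↥(maximalRealSubfield L)) L a) u)) ≠
          χ (QuotientGroup.mk (adelicCenter (↥(maximalRealSubfield L)) L (IsCMField.complexConj L) 1 (JW (↥(maximalRealSubfield L)) L a) u)) := by
      by_contra hall
      push Not at hall
      exact hχ (F0P6LD1ThetaCharacterPin.charQuot_ext_of_adelicCenter L a χ ξ fun u => (hall u).symm)
    obtain ⟨u, hu⟩ := hex
    exact inner_eq_zero_of_eigen_ne (ν := μA) _ (heig ξ u) (heig χ u) hu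
  -- (3) `w₀ := v - α • v_ξ` is orthogonal to every character class, hence to `v`: so `w₀ = 0`
  set α : ℂ := ⟪vξ, v⟫_ℂ / ⟪vξ, vξ⟫_ℂ with hα
  set w₀ : (adelicGroupData (↥(maximalRealSubfield L)) L (IsCMField.complexConj L) N H).L2 μA := v - α • vξ with hw₀
  have hvξvξ : ⟪vξ, vξ⟫_ℂ ≠ 0 := inner_self_ne_zero.mpr hvξ0
  have hw₀ξ : ⟪vξ, w₀⟫_ℂ = 0 := by
    rw [hw₀, inner_sub_right, inner_smul_right, hα, div_mul_cancel₀ _ hvξvξ, sub_self]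
  have hw₀χ : ∀ χ, ⟪w₀, MemLp.toLp _ (hmw (charCM χ))⟫_ℂ = 0 := by
    intro χ
    by_cases hχ : χ = ξ
    · subst hχ
      rw [← inner_conj_symm, hw₀ξ, map_zero]
    · rw [hw₀, inner_sub_left, inner_smul_left, Submodule.inner_right_of_mem_orthogonal hmem (horthP χ hχ), horthξ χ hχ, mul_zero, sub_zero]
  have hw₀v : ⟪w₀, v⟫_ℂ = 0 := by
    by_contra hne0
    have hT : (innerSL ℂ w₀) (MemLp.toLp _ (hmw f)) ≠ 0 := by rw [← hvf, innerSL_apply_apply]; exact hne0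
    obtain ⟨χ, hχ⟩ := F0LD1ThetaTransportKit.exists_charCM_of_apply_toLp_lineThetaLift_ne_zero L N H e₁ dV hdV hdV0 ιA hK lam hlam a hρ μW Φ f
      μA (innerSL ℂ w₀) hT
    exact hχ (by rw [innerSL_apply_apply]; exact hw₀χ χ)
  have hw₀0 : w₀ = 0 := by
    have h : ⟪w₀, w₀⟫_ℂ = 0 := by
      have h1 : ⟪w₀, vξ⟫_ℂ = 0 := by rw [← inner_conj_symm, hw₀ξ, map_zero]
      rw [show w₀ = v - α • vξ from rfl, inner_sub_right, inner_smul_right]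
      rw [← hw₀, hw₀v, h1, mul_zero, sub_zero]
    exact inner_self_eq_zero.mp h
  -- so `v = α • v_ξ` with `α ≠ 0`, and `v_ξ = α⁻¹ • v ∈ P`
  have hvα : v = α • vξ := by rw [← sub_eq_zero, ← hw₀]; exact hw₀0
  have hα0 : α ≠ 0 := by
    intro h0
    rw [h0, zero_smul] at hvα
    exact hne hvα
  have hvξP : vξ ∈ P.space.toSubmodule := by
    have h : vξ = α⁻¹ • v := by rw [hvα, smul_smul, inv_mul_cancel₀ hα0, one_smul]
    rw [h]
    exact P.space.toSubmodule.smul_mem _ hmem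
  exact ⟨ξ, hρ, μW, hfin, hinv, Φ, hmw (charCM ξ), hvξP, hvξ0⟩

end Seam

end Summit.HodgeConjecture.HodgeConjecture.Cruxes.HLiu418.F0P6LD1ThetaSeamCharacter

end
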